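import Literature.AlgebraicGeometry.HodgeTheory.BettiHodgeConjectureSquareAlgebraicCorrespondences
import Literature.AlgebraicGeometry.HodgeTheory.BettiHodgeConjectureSurfaceSquareGenericEndomorphisms
import Literature.AlgebraicGeometry.HodgeTheory.BettiHodgeConjectureProductNoExceptionalClasses
import HarnessLib

/-!
# `HC(X × X)` for `X` of EVEN dimension `n = 2h` with algebraic off-middle cohomology and `dim End_HS(HⁿX) ≤ ρ_h² + r`, where `r` algebraic correspondences act on `Hⁿ(X;ℂ)` linearly independently
# modulo the maps into `span_ℂ(Hdgʰ ⊗ 1)`; the pair `{[Δ], [ᵗΓ_σ]}` of an endomorphism; even-dimensional smooth hypersurfaces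
# (Voisin I §11.3.3 Thm. 11.38–11.40, Lemma 11.41, pp. 286–287; Voisin II proof of Thm. 10.17 (10.7); Voisin 2025 §3.2.1; Fulton §16.1)

Family `hodge`, lane `lit-hodgefound` (Track 2 foundations library; Layers A1/A4), layer `Literature/AlgebraicGeometry/HodgeTheory`.  THEOREMS ONLY (no definition, no named fact, no instance;
D-0026 net debt `0`).  Synthesis of the seat's g29-#8 (`BettiHodgeConjectureSquareEvenMiddleGenericEndomorphisms`: even `n`, `dim End_HS(HⁿX) ≤ ρ_h² + 1` through the diagonal) and g29-#11
(`BettiHodgeConjectureSquareAlgebraicCorrespondences`: any `n`, `dim End_HS(HⁿX) ≤ r` through `r` algebraic correspondences).  For `X` of even dimension `n = 2h`, off-middle algebraic with `HC(X)` and no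
odd cohomology, the Hodge classes of the middle piece `Hⁿ(X) ⊗ Hⁿ(X)` contain `P₀ = Hdgʰ(HⁿX) ⊗ Hdgʰ(HⁿX)` (dimension `ρ_h²`, algebraic cross products by `HC(X)`) and the middle Künneth components `tᵢ` of
any rational algebraic classes `γᵢ ∈ H^{2n}(X × X;ℚ)` (g29-#11 §1: algebraic cross products, acting on `Hⁿ(X;ℂ)` as `γᵢ`).  A class of `P₀` acts on `Hⁿ(X;ℂ)` with image in `M = span_ℂ(Hdgʰ ⊗ 1)` (g29-#4 §1,
the projection formula), so if NO non-trivial `ℂ`-combination of the `(γᵢ)_*` maps `Hⁿ(X;ℂ)` into `M`, then `P₀ ⊕ ⨁ ℚ tᵢ` has dimension `ρ_h² + r`; when `dim_ℚ End_HS(HⁿX) ≤ ρ_h² + r` it is all of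
`Hdgⁿ(HⁿX ⊗ HⁿX)` (Lemma 11.41) and `HC(X × X)` follows.

WHAT IS PROVED.
* §1 **`BettiUniverse.hodgeConjectureFor_tensor_self_of_offMiddle_algebraic_even_of_corrAction`**: the criterion just described (`ι` a finite index type; for `ι = ∅` it reads `dim End_HS(HⁿX) ≤ ρ_h²`,
  for `ι = {Δ}` and `Hdgʰ ≠ Hⁿ(X;ℚ)` it is g29-#8).
* §2 **`BettiUniverse.hodgeConjectureFor_tensor_self_of_offMiddle_algebraic_even_of_endomorphism`**: `σ : X ⟶ X` such that no non-trivial combination `a·Id + b·σ^*` maps `Hⁿ(X;ℂ)` into `span_ℂ(Hdgʰ ⊗ 1)`,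
  and `dim_ℚ End_HS(HⁿX) ≤ ρ_h² + 2` ⇒ `HC(X × X)` (the rational algebraic classes `[Δ]`, `[ᵗΓ_σ]` acting as `Id`, `σ^*`).
* §3 **`IsSmoothHypersurface.hodgeConjectureFor_tensor_self_of_even_of_corrAction`** / `…_of_even_of_endomorphism`: the readings on smooth hypersurfaces of even dimension with `HC(X)` (Voisin II
  Cor. 1.24/1.25 via g29-#7).

THE PRINTS.  C. Voisin (2002) [VoisinHodgeI2002] §11.3.3 Thm. 11.38, Thm. 11.40, Lemma 11.41, pp. 286–287.  C. Voisin (2003) [VoisinHodgeII2003] §1.2.3 Cor. 1.24–1.25, §9.2.4 Prop. 9.20, §10.2.2 proof of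
Thm. 10.17 (10.7).  C. Voisin (2025) [Voisin2025] §3.2.1 (12)–(14), Prop. 3.8, Cor. 3.9.  W. Fulton (1998) [Fulton1998] §16.1 Prop. 16.1.2, Def. 16.1.2.  B. Kahn (2020) [Kahn2020] §3.5.3 Example 3.47.
P. Deligne (2000/2006) [Deligne2000] §1.

THE OBJECTS (all the tree's).  `X : SchemeOver ℂ`, `hX : IsSmoothProjective n X`, `hXX : IsSmoothProjective d (X ⊗ X)`, `σ : X ⟶ X`; `hHD : exists_isReal_hodgeModel`; `Hᵏ(X) = BettiUniverse.hodge hHD hX k`,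
`hodgeClasses`, `HodgeStructure.Hom`, `tensor`; `BettiUniverse.kunnethSummand`, `BettiUniverse.crossMap`; `corrAction complexOrientationFamily`, `complexGysin`, `diagonalClass`, `complexBetti.map σ n`;
`TensorProduct.mapIncl`; `bettiCohomology`, `complexBetti`, `ofRatClass`, `algebraicClasses`, `HodgeConjectureFor`.

DEVIATIONS / SCOPE.  The independence-modulo-`span_ℂ(Hdgʰ ⊗ 1)` of the actions and the bound on `dim End_HS(HⁿX)` are hypotheses.  The odd-dimensional case is g29-#11.  No definitions.

## References
* [VoisinHodgeI2002] C. Voisin, *Hodge Theory and Complex Algebraic Geometry I* (2002) — §11.3.3 Thm. 11.38, Thm. 11.40, Lemma 11.41, pp. 286–287.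
* [VoisinHodgeII2003] C. Voisin, *Hodge Theory and Complex Algebraic Geometry II* (2003) — §1.2.3 Cor. 1.24–1.25; §9.2.4 Prop. 9.20; §10.2.2 proof of Thm. 10.17 (10.7).
* [Voisin2025] C. Voisin, *Cycle classes on algebraic varieties* (2025) — §3.2.1 (12)–(14), Prop. 3.8, Cor. 3.9.
* [Fulton1998] W. Fulton, *Intersection Theory* (2nd ed., 1998) — §16.1 Prop. 16.1.2, Def. 16.1.2.
* [Kahn2020] B. Kahn, *Zeta and L-functions of varieties and motives* (2020) — §3.5.3 Example 3.47.
* [Deligne2000] P. Deligne, *The Hodge conjecture* (Clay problem description) — §1.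
* [HatcherAT2002] A. Hatcher, *Algebraic Topology* (2002) — §3.1 p. 198.

## Provenance
Lane `lit-hodgefound` (Hodge path, Track 2), prover seat `lit-hodgefound-p29` (generation 29), self-proposed row g29-#12 (synthesis of g29-#8 and g29-#11).
-/

noncomputable section

open scoped TensorProduct
open CategoryTheory MonoidalCategory CartesianMonoidalCategory Module Finset
open Literature.AlgebraicTopology.SingularHomology
open Literature.Geometry.Kaehler

namespace Literature.AlgebraicGeometry.HodgeTheory

open Literature.AlgebraicGeometry.Motives
open Literature.AlgebraicGeometry.Motives.HodgeStructure

variable {n d : ℕ} {X : SchemeOver ℂ}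

/-! ### §0 Plumbing -/

/-- `(q • a) ⊗ 1 = q • (a ⊗ 1)` for the lattice map `Hᵏ(Y;ℚ) → Hᵏ(Y;ℂ)` (private copy of the tree's file-local lemma). [cite: HatcherAT2002, §3.1 p. 198] -/
private theorem ofRatClass_rat_smul' {T : Type} [TopologicalSpace T] {k : ℕ} (q : ℚ) (a : singularCohomology ℚ ℚ T k) :
    ofRatClass T k (q • a) = (q : ℂ) • ofRatClass T k a := by
  rw [ofRatClass, coeffClass_smul, smul_coeffClass]
  refine coeffClass_congr (fun x ↦ ?_) a
  simp

/-- `(y × z) ⊗ 1` is algebraic for `y ⊗ 1 ∈ Nᵃ(Y)`, `z ⊗ 1 ∈ Nᵇ(Z)`, at any total codimension `c = a + b` (the tree's `ofRatClass_crossMap_tmul_mem_algebraicClasses`, re-indexed).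
[cite: VoisinHodgeII2003, §9.2.4 proof of Prop. 9.20] -/
private theorem ofRatClass_crossMap_tmul_mem_algebraicClasses' {m' n' : ℕ} {Y Z : SchemeOver ℂ} (hY : IsSmoothProjective m' Y) (hZ : IsSmoothProjective n' Z) {a b c : ℕ}
    (hc : 2 * a + 2 * b = 2 * c) {y : bettiCohomology Y (2 * a)} {z : bettiCohomology Z (2 * b)} (hy : ofRatClass (ComplexPoints Y) (2 * a) y ∈ algebraicClasses Y a)
    (hz : ofRatClass (ComplexPoints Z) (2 * b) z ∈ algebraicClasses Z b) : ofRatClass (ComplexPoints (Y ⊗ Z)) (2 * c) (BettiUniverse.crossMap Y Z hc (y ⊗ₜ[ℚ] z)) ∈ algebraicClasses (Y ⊗ Z) c := by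
  obtain rfl : c = a + b := by omega
  exact BettiUniverse.ofRatClass_crossMap_tmul_mem_algebraicClasses hY hZ hy hz

/-! ### §1 Even dimension: `Hdgʰ ⊗ Hdgʰ` together with the middle components of algebraic correspondences -/

/-- **`HC(X × X)` for `X` of EVEN dimension `n = 2h`, off-middle algebraic with `HC(X)`, and `dim_ℚ End_HS(HⁿX) ≤ ρ_h² + |ι|` for a family of algebraic correspondences `γᵢ`, `i ∈ ι`, acting on `Hⁿ(X;ℂ)`
linearly independently modulo the maps into `span_ℂ(Hdgʰ(HⁿX) ⊗ 1)`.**  Here `ρ_h = dim_ℚ Hdgʰ(HⁿX)`; `X` has no odd cohomology and `Hdgᵖ(H^{2p}X) = H^{2p}(X;ℚ)` for `2p ≠ n`; the `γᵢ ∈ H^{2n}(X × X;ℚ)` have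
algebraic complexifications; and the independence hypothesis says: if `Σ cᵢ (γᵢ ⊗ 1)_*` maps `Hⁿ(X;ℂ)` into `span_ℂ(Hdgʰ ⊗ 1)` then all `cᵢ = 0`.  Proof: only the pieces `Hⁱ ⊗ Hʲ`, `1 ≤ i, j ≤ n`, matter
(g29-#2), those other than `Hⁿ ⊗ Hⁿ` vanish or have a pure factor (g29-#6 §1); if `Hdgʰ = Hⁿ(X;ℚ)` everything is pure (g27-#5); otherwise `Hdgʰ ⊗ Hdgʰ ⊕ ⨁ᵢ ℚ tᵢ` (`tᵢ` the middle Künneth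
component of `γᵢ`, g29-#11 §1; the sum is direct because a class of `Hdgʰ ⊗ Hdgʰ` acts with image in `span_ℂ(Hdgʰ ⊗ 1)`, pp. 286–287 / (10.7)) has dimension `ρ_h² + |ι| ≥ dim Hdgⁿ(HⁿX ⊗ HⁿX)`
(`= dim End_HS(HⁿX)`, Lemma 11.41), so it is the space of Hodge classes of the middle piece, all with algebraic cross products. [cite: VoisinHodgeI2002, §11.3.3 Thm. 11.38–11.40, Lemma 11.41 and pp. 286–287]
[cite: VoisinHodgeII2003, §10.2.2 proof of Thm. 10.17 (10.7)] [cite: Voisin2025, §3.2.1 (12)–(14), Prop. 3.8 and Cor. 3.9] [cite: Deligne2000, §1] -/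
theorem BettiUniverse.hodgeConjectureFor_tensor_self_of_offMiddle_algebraic_even_of_corrAction {ι : Type} [Fintype ι] (hHD : exists_isReal_hodgeModel) (hX : IsSmoothProjective n X)
    (hXX : IsSmoothProjective d (X ⊗ X)) (hHC : HodgeConjectureFor n X) {h : ℕ} (hn : n = 2 * h) (hodd : ∀ k, Odd k → Module.finrank ℚ (bettiCohomology X k) = 0)
    (heven : ∀ p, 2 * p ≠ n → (BettiUniverse.hodge hHD hX (2 * p)).hodgeClasses p = ⊤) (γ : ι → bettiCohomology (X ⊗ X) (2 * n))
    (hγ : ∀ i, ofRatClass (ComplexPoints (X ⊗ X)) (2 * n) (γ i) ∈ algebraicClasses (X ⊗ X) n)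
    (hind : ∀ c : ι → ℂ, (∀ u : complexBetti X n, (∑ i, c i • corrAction complexOrientationFamily hX hX (rfl : n + 2 * n = n + 2 * n) (ofRatClass (ComplexPoints (X ⊗ X)) (2 * n) (γ i))) u ∈
        Submodule.span ℂ (ofRatClass (ComplexPoints X) n '' ((BettiUniverse.hodge hHD hX n).hodgeClasses h : Set (bettiCohomology X n)))) → ∀ i, c i = 0)
    (hEnd : Module.finrank ℚ (HodgeStructure.Hom (BettiUniverse.hodge hHD hX n) (BettiUniverse.hodge hHD hX n)) ≤ Module.finrank ℚ ↥((BettiUniverse.hodge hHD hX n).hodgeClasses h) ^ 2 + Fintype.card ι) :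
    HodgeConjectureFor d (X ⊗ X) := by
  classical
  haveI : HodgeTensorFacts.{0, 0} := hodgeTensorFacts_holds
  subst hn
  haveI := BettiUniverse.finite hX (2 * h)
  have halgX : ∀ (p : ℕ), ∀ z ∈ (BettiUniverse.hodge hHD hX (2 * p)).hodgeClasses (p : ℤ), ofRatClass (ComplexPoints X) (2 * p) z ∈ algebraicClasses X p :=
    fun p z hz ↦ hHC.2 p _ (isRationalClass_ofRatClass _) ((BettiUniverse.mem_hodgeClasses_hodge_iff_isOfHodgeType hHD hX p z).1 hz)
  -- the pure case: `Hdgʰ(HⁿX) = Hⁿ(X;ℚ)`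
  by_cases htop : (BettiUniverse.hodge hHD hX (2 * h)).hodgeClasses h = ⊤
  · refine BettiUniverse.hodgeConjectureFor_tensor_of_pure_even_of_odd_vanishing hHD hX hX hXX (fun a ↦ ?_) hodd hHC hHC
    by_cases ha : 2 * a = 2 * h
    · obtain rfl : a = h := by omega
      exact htop
    · exact heven a ha
  -- the middle components of the `γ i`
  choose t ht halg hact using fun i ↦ BettiUniverse.exists_kunneth_middle_algebraic_corrAction_eq hHD hX hHC (fun k hk _ ↦ hodd k hk) heven (hγ i)
  set NS := (BettiUniverse.hodge hHD hX (2 * h)).hodgeClasses (h : ℤ) with hNS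
  set P₀ : Submodule ℚ (bettiCohomology X (2 * h) ⊗[ℚ] bettiCohomology X (2 * h)) := LinearMap.range (TensorProduct.mapIncl NS NS) with hP₀
  set T : Submodule ℚ (bettiCohomology X (2 * h) ⊗[ℚ] bettiCohomology X (2 * h)) := Submodule.span ℚ (Set.range t) with hT
  -- the action of `crossMap (Σ cᵢ tᵢ) ⊗ 1` is `Σ cᵢ (γᵢ ⊗ 1)_*`
  have haction : ∀ c : ι → ℚ, corrAction complexOrientationFamily hX hX (rfl : 2 * h + 2 * (2 * h) = 2 * h + 2 * (2 * h))
      (ofRatClass (ComplexPoints (X ⊗ X)) (2 * (2 * h)) (BettiUniverse.crossMap X X (two_mul (2 * h)).symm (∑ i, c i • t i))) =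
        ∑ i, ((c i : ℚ) : ℂ) • corrAction complexOrientationFamily hX hX (rfl : 2 * h + 2 * (2 * h) = 2 * h + 2 * (2 * h)) (ofRatClass (ComplexPoints (X ⊗ X)) (2 * (2 * h)) (γ i)) := by
    intro c
    simp only [map_sum, map_smul, ofRatClass_rat_smul']
    simp_rw [hact]
  -- key: a `ℚ`-combination of the `tᵢ` inside `Hdgʰ ⊗ Hdgʰ` is trivial
  have hkey : ∀ c : ι → ℚ, (∑ i, c i • t i) ∈ P₀ → ∀ i, c i = 0 := by
    intro c hmem i
    have hc := hind (fun i ↦ ((c i : ℚ) : ℂ)) (fun u ↦ by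
      have hu := corrAction_ofRatClass_crossMap_mem_span_of_mem_range_mapIncl complexOrientationFamily hasPoincareDuality_complexOrientationFamily hX hX (two_mul (2 * h)).symm
        (two_mul (2 * h)).symm (rfl : 2 * h + 2 * (2 * h) = 2 * h + 2 * (2 * h)) NS NS hmem u
      rwa [haction c] at hu) i
    exact_mod_cast hc
  have hli : LinearIndependent ℚ t := by
    rw [Fintype.linearIndependent_iff]
    intro g hg
    exact hkey g (by rw [hg]; exact Submodule.zero_mem _)
  have hinf : P₀ ⊓ T = ⊥ := by
    refine eq_bot_iff.2 fun x hx ↦ ?_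
    obtain ⟨hx₀, hx₁⟩ := Submodule.mem_inf.1 hx
    obtain ⟨c, rfl⟩ := (Submodule.mem_span_range_iff_exists_fun ℚ).1 hx₁
    rw [Submodule.mem_bot]
    exact Finset.sum_eq_zero fun i _ ↦ by rw [hkey c hx₀ i, zero_smul]
  refine BettiUniverse.hodgeConjectureFor_tensor_of_kunneth_pieces_pos_le hHD hX hX hXX hHC hHC fun c i j hij hi1 hi hj1 hj hc2 u hu ↦ ?_
  by_cases hmid : i = 2 * h ∧ j = 2 * h
  · -- the middle piece `Hⁿ ⊗ Hⁿ`
    obtain ⟨hin, hjn⟩ := hmid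
    subst hin
    subst hjn
    obtain rfl : c = 2 * h := by omega
    have hidx : (((2 * h : ℕ)) : ℤ) = (h : ℤ) + h := by push_cast; ring
    have hP₀le : P₀ ≤ ((BettiUniverse.hodge hHD hX (2 * h)).tensor (BettiUniverse.hodge hHD hX (2 * h))).hodgeClasses (((2 * h : ℕ)) : ℤ) := by
      rw [hP₀, TensorProduct.range_mapIncl, Submodule.map₂_le]
      intro y hy z hz
      have hyz := HodgeStructure.tmul_mem_hodgeClasses_tensor _ _ hy hz
      rw [← hidx] at hyz
      exact hyz
    have ht' : ∀ k, t k ∈ ((BettiUniverse.hodge hHD hX (2 * h)).tensor (BettiUniverse.hodge hHD hX (2 * h))).hodgeClasses (((2 * h : ℕ)) : ℤ) := fun k ↦ ht k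
    have hTle : T ≤ ((BettiUniverse.hodge hHD hX (2 * h)).tensor (BettiUniverse.hodge hHD hX (2 * h))).hodgeClasses (((2 * h : ℕ)) : ℤ) :=
      Submodule.span_le.2 (Set.range_subset_iff.2 ht')
    have hPle : P₀ ⊔ T ≤ ((BettiUniverse.hodge hHD hX (2 * h)).tensor (BettiUniverse.hodge hHD hX (2 * h))).hodgeClasses (((2 * h : ℕ)) : ℤ) := sup_le hP₀le hTle
    haveI : Module.Free ℚ ↥NS := Module.Free.of_divisionRing ℚ _
    have hP₀rank : Module.finrank ℚ ↥P₀ = Module.finrank ℚ ↥NS * Module.finrank ℚ ↥NS := by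
      rw [hP₀, LinearMap.finrank_range_of_inj (Module.Flat.tensorProduct_mapIncl_injective_of_right _ _), Module.finrank_tensorProduct]
    have hTrank : Module.finrank ℚ ↥T = Fintype.card ι := finrank_span_eq_card hli
    have hPrank : Module.finrank ℚ ↥(P₀ ⊔ T) = Module.finrank ℚ ↥NS * Module.finrank ℚ ↥NS + Fintype.card ι := by
      have e := Submodule.finrank_sup_add_finrank_inf_eq P₀ T
      rw [hinf, finrank_bot, add_zero, hP₀rank, hTrank] at e
      exact e
    have hHrank : Module.finrank ℚ ↥(((BettiUniverse.hodge hHD hX (2 * h)).tensor (BettiUniverse.hodge hHD hX (2 * h))).hodgeClasses (((2 * h : ℕ)) : ℤ)) =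
        Module.finrank ℚ (HodgeStructure.Hom (BettiUniverse.hodge hHD hX (2 * h)) (BettiUniverse.hodge hHD hX (2 * h))) :=
      BettiUniverse.finrank_hodgeClasses_tensor_hodge_eq_finrank_hom hHD hX hX (2 * h)
    have hPeq : P₀ ⊔ T = ((BettiUniverse.hodge hHD hX (2 * h)).tensor (BettiUniverse.hodge hHD hX (2 * h))).hodgeClasses (((2 * h : ℕ)) : ℤ) :=
      Submodule.eq_of_le_of_finrank_le hPle (by rw [hHrank, hPrank]; nlinarith [hEnd, sq (Module.finrank ℚ ↥NS)])
    have hu' : u ∈ P₀ ⊔ T := by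
      rw [hPeq]
      exact hu
    obtain ⟨p, hp, z, hz, rfl⟩ := Submodule.mem_sup.1 hu'
    obtain ⟨cf, rfl⟩ := (Submodule.mem_span_range_iff_exists_fun ℚ).1 hz
    rw [map_add, map_add]
    refine Submodule.add_mem _ ?_ ?_
    · -- `p ∈ Hdgʰ ⊗ Hdgʰ`: exterior products of algebraic classes (`HC(X)`)
      rw [hP₀] at hp
      obtain ⟨w, rfl⟩ := hp
      clear hu hu'
      induction w using TensorProduct.induction_on with
      | zero => rw [map_zero, map_zero, map_zero]; exact Submodule.zero_mem _
      | tmul a b =>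
        rw [TensorProduct.mapIncl, TensorProduct.map_tmul, Submodule.subtype_apply, Submodule.subtype_apply]
        exact ofRatClass_crossMap_tmul_mem_algebraicClasses' hX hX hij (halgX h _ a.2) (halgX h _ b.2)
      | add x y hx hy => rw [map_add, map_add, map_add]; exact Submodule.add_mem _ hx hy
    · -- `Σ cᵢ tᵢ`
      rw [map_sum, map_sum]
      refine Submodule.sum_mem _ fun k _ ↦ ?_
      rw [map_smul, ofRatClass_rat_smul']
      exact Submodule.smul_mem _ _ (halg k)
  -- the other pieces: zero or with a pure factor
  rcases Nat.even_or_odd i with ⟨a, ha⟩ | hio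
  · obtain ⟨a, rfl⟩ : ∃ a', i = 2 * a' := ⟨a, by omega⟩
    obtain ⟨b, rfl⟩ : ∃ b, j = 2 * b := ⟨j / 2, by omega⟩
    by_cases han : 2 * a = 2 * h
    · have hbn : 2 * b ≠ 2 * h := fun hb ↦ hmid ⟨han, hb⟩
      exact BettiUniverse.ofRatClass_crossMap_mem_algebraicClasses_of_hodgeClasses_eq_top_right hHD hX hX hij (heven b hbn) (halgX a)
        (fun z ↦ halgX b z (by rw [heven b hbn]; exact Submodule.mem_top)) hu
    · exact BettiUniverse.ofRatClass_crossMap_mem_algebraicClasses_of_hodgeClasses_eq_top_left hHD hX hX hij (heven a han)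
        (fun z ↦ halgX a z (by rw [heven a han]; exact Submodule.mem_top)) (halgX b) hu
  · exact BettiUniverse.ofRatClass_crossMap_mem_algebraicClasses_of_finrank_eq_zero hX hX hij (Or.inl (hodd i hio)) u

/-! ### §2 One endomorphism in even dimension -/

/-- **`HC(X × X)` in even dimension from the diagonal and the graph of an endomorphism.**  `X` of even dimension `n = 2h`, off-middle algebraic with `HC(X)` and no odd cohomology; `σ : X ⟶ X` such that NO
non-trivial combination `a·Id + b·σ^*` maps `Hⁿ(X;ℂ)` into `span_ℂ(Hdgʰ(HⁿX) ⊗ 1)`; `dim_ℚ End_HS(HⁿX) ≤ ρ_h² + 2`.  Then `HC(X × X)` (§1 with the rational algebraic classes `[Δ] = (𝟙,𝟙)_* 1` and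
`[ᵗΓ_σ] = (𝟙,σ)_* 1`, acting as `Id` and `σ^*`). [cite: VoisinHodgeI2002, §11.3.3 Lemma 11.41 and pp. 286–287] [cite: Fulton1998, §16.1 Prop. 16.1.2 and Def. 16.1.2] [cite: Kahn2020, §3.5.3 Example 3.47] [cite: Deligne2000, §1] -/
theorem BettiUniverse.hodgeConjectureFor_tensor_self_of_offMiddle_algebraic_even_of_endomorphism (hHD : exists_isReal_hodgeModel) (hX : IsSmoothProjective n X) (hXX : IsSmoothProjective d (X ⊗ X))
    (hHC : HodgeConjectureFor n X) {h : ℕ} (hn : n = 2 * h) (hodd : ∀ k, Odd k → Module.finrank ℚ (bettiCohomology X k) = 0)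
    (heven : ∀ p, 2 * p ≠ n → (BettiUniverse.hodge hHD hX (2 * p)).hodgeClasses p = ⊤) (σ : X ⟶ X)
    (hind : ∀ a b : ℂ, (∀ u : complexBetti X n, a • u + b • (complexBetti.map σ n).hom u ∈
        Submodule.span ℂ (ofRatClass (ComplexPoints X) n '' ((BettiUniverse.hodge hHD hX n).hodgeClasses h : Set (bettiCohomology X n)))) → a = 0 ∧ b = 0)
    (hEnd : Module.finrank ℚ (HodgeStructure.Hom (BettiUniverse.hodge hHD hX n) (BettiUniverse.hodge hHD hX n)) ≤ Module.finrank ℚ ↥((BettiUniverse.hodge hHD hX n).hodgeClasses h) ^ 2 + 2) :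
    HodgeConjectureFor d (X ⊗ X) := by
  -- rational lifts of `[Δ]` and `[ᵗΓ_σ]`
  obtain ⟨δ, hδ⟩ := (isRationalClass_iff_mem_range_ofRatClass _).1 (isRationalClass_diagonalClass hX)
  obtain ⟨γ, hγ⟩ := (isRationalClass_iff_mem_range_ofRatClass _).1
    (isRationalClass_complexGysin_complexOrientationFamily hX (hX.tensor_holds hX) (lift (𝟙 X) σ) (show 0 + 2 * (n + n) = 2 * n + 2 * n by omega) (isRationalClass_one _) :
      IsRationalClass (complexGysin complexOrientationFamily hX (hX.tensor_holds hX) (lift (𝟙 X) σ) (show 0 + 2 * (n + n) = 2 * n + 2 * n by omega)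
        (singularCohomology.one ℂ (ComplexPoints X))))
  have hδalg : ofRatClass (ComplexPoints (X ⊗ X)) (2 * n) δ ∈ algebraicClasses (X ⊗ X) n := by
    rw [hδ]
    exact diagonalClass_mem_algebraicClasses hX
  have hγalg : ofRatClass (ComplexPoints (X ⊗ X)) (2 * n) γ ∈ algebraicClasses (X ⊗ X) n := by
    rw [hγ]
    exact complexGysin_graph_one_mem_algebraicClasses complexOrientationFamily hasPoincareDuality_complexOrientationFamily hX (hX.tensor_holds hX) σ
  have hδact : corrAction complexOrientationFamily hX hX (rfl : n + 2 * n = n + 2 * n) (ofRatClass (ComplexPoints (X ⊗ X)) (2 * n) δ) = LinearMap.id := by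
    rw [hδ]
    exact corrAction_diagonalClass_eq_id hX rfl
  have hγact : corrAction complexOrientationFamily hX hX (rfl : n + 2 * n = n + 2 * n) (ofRatClass (ComplexPoints (X ⊗ X)) (2 * n) γ) = (complexBetti.map σ n).hom := by
    rw [hγ]
    exact corrAction_transposeGraph_one complexOrientationFamily hX hX σ rfl
  refine BettiUniverse.hodgeConjectureFor_tensor_self_of_offMiddle_algebraic_even_of_corrAction (ι := Fin 2) hHD hX hXX hHC hn hodd heven ![δ, γ]
    (fun i ↦ by fin_cases i <;> simp [hδalg, hγalg]) (fun c hc ↦ ?_) (by simpa using hEnd)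
  have hab := hind (c 0) (c 1) fun u ↦ by
    have hu := hc u
    simp only [Fin.sum_univ_two, LinearMap.add_apply, LinearMap.smul_apply, Matrix.cons_val_zero, Matrix.cons_val_one, hδact, hγact, LinearMap.id_apply] at hu
    exact hu
  intro i
  fin_cases i
  · exact hab.1
  · exact hab.2

end Literature.AlgebraicGeometry.HodgeTheory

/-! ### §3 Smooth hypersurfaces of even dimension -/

namespace Literature.AlgebraicGeometry.Motives.IsSmoothHypersurface

open Literature.AlgebraicGeometry.Motives
open Literature.AlgebraicGeometry.HodgeTheory

variable {m e : ℕ} {Y : SchemeOver ℂ}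

/-- **`HC(Y × Y)` for a smooth hypersurface `Y` of EVEN dimension `m = 2h` with `HC(Y)` and `dim_ℚ End_HS(HᵐY) ≤ ρ_h² + |ι|` for algebraic correspondences `γᵢ` acting on `Hᵐ(Y;ℂ)` independently modulo
the maps into `span_ℂ(Hdgʰ ⊗ 1)`** (Cor. 1.24/1.25 via g29-#7, then §1). [cite: VoisinHodgeII2003, §1.2.3 Cor. 1.24 and Cor. 1.25] [cite: VoisinHodgeI2002, §11.3.3 Lemma 11.41 and pp. 286–287] -/
theorem hodgeConjectureFor_tensor_self_of_even_of_corrAction {ι : Type} [Fintype ι] (hY : IsSmoothHypersurface m e Y) (hHD : exists_isReal_hodgeModel) {h : ℕ} (hm : m = 2 * h)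
    (hHC : HodgeConjectureFor m Y) (γ : ι → bettiCohomology (Y ⊗ Y) (2 * m)) (hγ : ∀ i, ofRatClass (ComplexPoints (Y ⊗ Y)) (2 * m) (γ i) ∈ algebraicClasses (Y ⊗ Y) m)
    (hind : ∀ c : ι → ℂ, (∀ u : complexBetti Y m, (∑ i, c i • corrAction complexOrientationFamily hY.1 hY.1 (rfl : m + 2 * m = m + 2 * m) (ofRatClass (ComplexPoints (Y ⊗ Y)) (2 * m) (γ i))) u ∈
        Submodule.span ℂ (ofRatClass (ComplexPoints Y) m '' ((BettiUniverse.hodge hHD hY.1 m).hodgeClasses h : Set (bettiCohomology Y m)))) → ∀ i, c i = 0)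
    (hEnd : Module.finrank ℚ (HodgeStructure.Hom (BettiUniverse.hodge hHD hY.1 m) (BettiUniverse.hodge hHD hY.1 m)) ≤ Module.finrank ℚ ↥((BettiUniverse.hodge hHD hY.1 m).hodgeClasses h) ^ 2 + Fintype.card ι) :
    HodgeConjectureFor (m + m) (Y ⊗ Y) :=
  BettiUniverse.hodgeConjectureFor_tensor_self_of_offMiddle_algebraic_even_of_corrAction hHD hY.1 (hY.1.tensor_holds hY.1) hHC hm
    (fun _ hk ↦ hY.finrank_bettiCohomology_eq_zero_of_odd hk fun hkm ↦ (Nat.not_even_iff_odd.2 hk) ⟨h, by omega⟩) (fun _ hp ↦ hY.hodgeClasses_hodge_eq_top_of_two_mul_ne hHD hY.1 hp) γ hγ hind hEnd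

/-- **`HC(Y × Y)` for a smooth hypersurface `Y` of even dimension `m = 2h` with `HC(Y)`, an endomorphism `σ` with no non-trivial `a·Id + b·σ^*` mapping `Hᵐ(Y;ℂ)` into `span_ℂ(Hdgʰ ⊗ 1)`, and
`dim_ℚ End_HS(HᵐY) ≤ ρ_h² + 2`.** [cite: VoisinHodgeII2003, §1.2.3 Cor. 1.24 and Cor. 1.25] [cite: VoisinHodgeI2002, §11.3.3 Lemma 11.41 and pp. 286–287] [cite: Fulton1998, §16.1 Def. 16.1.2] -/
theorem hodgeConjectureFor_tensor_self_of_even_of_endomorphism (hY : IsSmoothHypersurface m e Y) (hHD : exists_isReal_hodgeModel) {h : ℕ} (hm : m = 2 * h) (hHC : HodgeConjectureFor m Y) (σ : Y ⟶ Y)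
    (hind : ∀ a b : ℂ, (∀ u : complexBetti Y m, a • u + b • (complexBetti.map σ m).hom u ∈
        Submodule.span ℂ (ofRatClass (ComplexPoints Y) m '' ((BettiUniverse.hodge hHD hY.1 m).hodgeClasses h : Set (bettiCohomology Y m)))) → a = 0 ∧ b = 0)
    (hEnd : Module.finrank ℚ (HodgeStructure.Hom (BettiUniverse.hodge hHD hY.1 m) (BettiUniverse.hodge hHD hY.1 m)) ≤ Module.finrank ℚ ↥((BettiUniverse.hodge hHD hY.1 m).hodgeClasses h) ^ 2 + 2) :
    HodgeConjectureFor (m + m) (Y ⊗ Y) :=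
  BettiUniverse.hodgeConjectureFor_tensor_self_of_offMiddle_algebraic_even_of_endomorphism hHD hY.1 (hY.1.tensor_holds hY.1) hHC hm
    (fun _ hk ↦ hY.finrank_bettiCohomology_eq_zero_of_odd hk fun hkm ↦ (Nat.not_even_iff_odd.2 hk) ⟨h, by omega⟩) (fun _ hp ↦ hY.hodgeClasses_hodge_eq_top_of_two_mul_ne hHD hY.1 hp) σ hind hEnd

end Literature.AlgebraicGeometry.Motives.IsSmoothHypersurface

end
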